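import Literature.NumberTheory.EllipticCurves.ModularFormsGamma1Dimension
import Literature.NumberTheory.EllipticCurves.ModularFormsLevelCuspsGeneral
import Literature.NumberTheory.EllipticCurves.ModularFormsGamma1AllCharRankInput
import HarnessLib

/-!
# The lower bound `12 dim S_k(Γ₁(N)) ≥ (k-1)[SL₂(ℤ):±Γ₁(N)] - 6ε_∞` in **odd** weight `k`
# (`N ≥ 5`; Diamond–Shurman Thm. 3.6.1 / Fig. 3.4, existence half), by the free-module route
# for `Γ₁(N) ∌ -1` — hence in every weight

`ModularFormsGamma1Dimension` proved `12 dim S_k(Γ₁(N)) ≥ (k-1)μ₁ - 6ε_∞` for *even* `k`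
(`μ₁ = [SL₂(ℤ):±Γ₁(N)]`, `ε_∞ = #Level.basePoints(±Γ₁(N))`, the number of `⟨T⟩`-orbits on
`SL₂(ℤ)/±Γ₁(N)`) from the level-one basis of the even-weight forms `M(±Γ₁(N))`. Odd weights live on
`Γ₁(N)` itself (`-1 ∉ Γ₁(N)`), and `ModularFormsLevelFreeModuleGeneral`, `…RankGeneral`,
`…CuspsGeneral`, `ModularFormsGamma1AllCharRankInput` supply a level-one basis `(F_j)` of
`M(Γ₁(N)) = ⊕_{k ∈ ℤ} M_k(Γ₁(N))` on `2μ₁ = [SL₂(ℤ):Γ₁(N)]` generators of weights `k_j ≥ 0`, `μ₁` of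
each parity, equidistributed modulo `4` and `6` (`N ≥ 4`), with
`∑_j k_j + 6c = 12μ₁`, `c = #Level.basePoints(Γ₁(N))`. This file assembles the odd case:

* `Level.isLevelBasis_adjoinNegI_evenPart`: **the even-weight part of a level-one basis of `M(Γ)`
  is a level-one basis of `M(±Γ)`**; for `Γ₁(N)` the landed cusp constraint of `±Γ₁(N)`
  (`Level.totalWeight_eq`, `ModularFormsLevelCusps`) then gives `∑_{k_j even} k_j = 6μ₁ - 6ε_∞`, so
  `∑_{k_j odd} k_j = 6μ₁ + 6ε_∞ - 6c`.
* `Level.two_mul_finrank_levelSpace_le` — **the cusp-value map factors through pairs**: if no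
  translate `Tⁱx` of a coset equals `-x` (for `Γ₁(N)`: no element of trace `-2`, i.e. `N ∤ 4`,
  `T_pow_smul_ne_neg_smul_gamma1`), the base points `b` and `b* = base(-b)` are distinct, `b** = b`,
  and the values at `i∞` of the conjugates of `f ∈ M_k(Γ)` satisfy `v(f ∣ b*) = (-1)^k v(f ∣ b)`
  (`valueAtInfty_cosetSlash_base_neg`); so `2 dim M_k(Γ) ≤ 2 dim S_k(Γ) + c`.
* per-weight bookkeeping in odd `k` (`twelve_mul_finrank_gamma1_odd_ge`): only the odd `k_j`
  contribute, `k - k_j` runs through the residues `0, 2 (4)` and `0, 2, 4 (6)` equally often, whence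
  `12 dim M_k(Γ₁(N)) ≥ (k+5)μ₁ - ∑_{k_j odd} k_j`, and with the two displayed identities the count
  `c` cancels:

  **`le_twelve_mul_finrank_cuspForm_gamma1_odd`**: `(k-1)μ₁ - 6ε_∞ ≤ 12 dim S_k(Γ₁(N))` for
  `N ≥ 5` and odd `k`; with the even case, **`le_twelve_mul_finrank_cuspForm_gamma1_all`**: the same
  bound in every weight `k` for `N ≥ 5` (for `k ≥ 3` its right-hand side is `12` times the exact
  dimension `(k-1)(g-1) + (k/2 - 1)ε_∞` of Diamond–Shurman Fig. 3.4, all cusps of `Γ₁(N)` being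
  regular for `N ≠ 4`).

This is the dimension input, in odd weight, of the rank half of Eichler–Shimura for `Γ₁(N)`
(period lattice of `S_k(Γ₁(N))`, `k` odd ≥ 7). Everything is proved; no named facts.

## References

* F. Diamond, J. Shurman, *A first course in modular forms*, GTM 228 (2005), Thm. 3.6.1, Fig. 3.4,
  §3.8–3.9.
* T. Gannon, *The theory of vector-valued modular forms for the modular group* (2014), Thm. 3.4.
* G. Shimura, *Introduction to the arithmetic theory of automorphic functions* (1971), Thm. 2.25.
-/

noncomputable section

open UpperHalfPlane hiding I
open ModularForm Complex Matrix.SpecialLinearGroup Filter Asymptotics CongruenceSubgroup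
open scoped MatrixGroups Real ModularForm Topology Manifold

namespace Literature.NumberTheory.EllipticCurves.ModularForms

namespace Level

/-! ### The even part of a level-one basis of `M(Γ)` is a level-one basis of `M(±Γ)` -/

section EvenPart

variable {Γ : Subgroup SL(2, ℤ)} [Γ.FiniteIndex] [hT : Fact (ModularGroup.T ∈ Γ)]
variable {r : ℕ} {wt : Fin r → ℤ} {F : Fin r → ℍ → ℂ}

omit hT in
/-- **The even-weight generators of a level-one basis of `M(Γ)` form a level-one basis of `M(±Γ)`**
(`M_m(±Γ) = M_m(Γ)` for even `m`, `= 0` for odd `m`; level-one coefficients of odd weight vanish).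
[folklore] -/
theorem isLevelBasis_adjoinNegI_evenPart (hb : IsLevelBasis Γ wt F) {r₀ : ℕ}
    (e₀ : Fin r₀ ≃ {j : Fin r // wt j % 2 = 0}) :
    IsLevelBasis (adjoinNegI Γ) (fun i ↦ wt (e₀ i)) (fun i ↦ F (e₀ i)) := by
  classical
  have heven : ∀ i, Even (wt (e₀ i)) := fun i ↦ Int.even_iff.mpr (e₀ i).2
  refine ⟨fun i ↦ ?_, fun m f hf ↦ ?_, fun m p hp h0 ↦ ?_⟩
  · rw [levelSpace_adjoinNegI_eq_of_even Γ (heven i)]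
    exact hb.mem _
  · rcases Int.even_or_odd m with hm | hm
    · rw [levelSpace_adjoinNegI_eq_of_even Γ hm] at hf
      obtain ⟨p, hp, hfp⟩ := hb.span m f hf
      refine ⟨fun i ↦ p (e₀ i), fun i ↦ hp _, ?_⟩
      -- the odd-weight coefficients vanish
      have hzero : ∀ j : Fin r, ¬ wt j % 2 = 0 → p j = 0 := fun j hj ↦ by
        have hodd : Odd (m - wt j) := by
          obtain ⟨a, ha⟩ := hm
          have := Int.emod_two_eq_zero_or_one (wt j)
          exact ⟨(m - wt j) / 2, by omega⟩
        have := hp j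
        rwa [levelOneSpace_eq_bot_of_odd hodd, Submodule.mem_bot] at this
      have hsplit : ∑ j, p j * F j = ∑ j ∈ Finset.univ.filter (fun j ↦ wt j % 2 = 0), p j * F j := by
        rw [← Finset.sum_filter_add_sum_filter_not Finset.univ (fun j ↦ wt j % 2 = 0)]
        have : ∑ j ∈ Finset.univ.filter (fun j ↦ ¬ wt j % 2 = 0), p j * F j = 0 :=
          Finset.sum_eq_zero fun j hj ↦ by rw [hzero j (Finset.mem_filter.mp hj).2, zero_mul]
        rw [this, add_zero]
      rw [hfp, hsplit, Finset.sum_subtype (Finset.univ.filter fun j ↦ wt j % 2 = 0)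
        (p := fun j ↦ wt j % 2 = 0) (fun j ↦ by simp)]
      exact (Fintype.sum_equiv e₀ (fun i ↦ p (e₀ i) * F (e₀ i))
        (fun x : {j : Fin r // wt j % 2 = 0} ↦ p x * F x) fun i ↦ rfl).symm
    · have : levelSpace (adjoinNegI Γ) m = ⊥ := levelSpace_eq_bot_of_odd _ neg_one_mem_adjoinNegI hm
      rw [this, Submodule.mem_bot] at hf
      refine ⟨fun _ ↦ 0, fun _ ↦ Submodule.zero_mem _, ?_⟩
      simp [hf]
  · -- extend `p` by zero to all generators
    let P : Fin r → ℍ → ℂ := fun j ↦ if h : wt j % 2 = 0 then p (e₀.symm ⟨j, h⟩) else 0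
    have hP : ∀ j, P j ∈ levelOneSpace (m - wt j) := fun j ↦ by
      by_cases h : wt j % 2 = 0
      · simp only [P, h, dif_pos]
        have := hp (e₀.symm ⟨j, h⟩)
        simpa using this
      · simp only [P, h, dif_neg, not_false_eq_true]
        exact Submodule.zero_mem _
    have hPsum : ∑ j, P j * F j = 0 := by
      rw [← Finset.sum_filter_add_sum_filter_not Finset.univ (fun j ↦ wt j % 2 = 0)]
      have hz : ∑ j ∈ Finset.univ.filter (fun j ↦ ¬ wt j % 2 = 0), P j * F j = 0 :=
        Finset.sum_eq_zero fun j hj ↦ by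
          have h := (Finset.mem_filter.mp hj).2
          simp only [P, dif_neg h, zero_mul]
      rw [hz, add_zero, Finset.sum_subtype (Finset.univ.filter fun j ↦ wt j % 2 = 0)
        (p := fun j ↦ wt j % 2 = 0) (fun j ↦ by simp), ← h0]
      refine (Fintype.sum_equiv e₀ _ _ fun i ↦ ?_).symm
      simp only [P, dif_pos (e₀ i).2]
      rw [show (⟨(e₀ i).1, (e₀ i).2⟩ : {j : Fin r // wt j % 2 = 0}) = e₀ i from rfl,
        Equiv.symm_apply_apply]
    intro i
    have := hb.indep m P hP hPsum (e₀ i)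
    simp only [P, dif_pos (e₀ i).2] at this
    rwa [show (⟨(e₀ i).1, (e₀ i).2⟩ : {j : Fin r // wt j % 2 = 0}) = e₀ i from rfl,
      Equiv.symm_apply_apply] at this

end EvenPart

/-! ### Pairing the `⟨T⟩`-orbits by `-1` and the cusp-value map in a level without `-T`-conjugates -/

section Pairs

variable {Γ : Subgroup SL(2, ℤ)} [Γ.FiniteIndex] {k : ℤ}

local notation "𝕏" => SL(2, ℤ) ⧸ Γ

open scoped Classical

/-- `(base(-b))* ` returns to `b`: `base(-base(-x)) = base x`. [folklore] -/
theorem base_neg_base_neg (x : 𝕏) :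
    base Γ ((-1 : SL(2, ℤ)) • base Γ ((-1 : SL(2, ℤ)) • x)) = base Γ x := by
  have hx : (-1 : SL(2, ℤ)) • ((-1 : SL(2, ℤ)) • x) = x := by
    rw [smul_smul, show (-1 : SL(2, ℤ)) * -1 = 1 by simp, one_smul]
  rw [← T_zpow_neg_off_smul ((-1 : SL(2, ℤ)) • x), ← T_zpow_smul_neg_one_smul, hx, base_T_zpow_smul]

/-- If no translate `Tⁱ x` equals `-x`, the partner `base(-b)` of a base point `b` is not `b`.
[folklore] -/
theorem base_neg_ne (hreg : ∀ (x : 𝕏) (i : ℕ), ModularGroup.T ^ i • x ≠ (-1 : SL(2, ℤ)) • x)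
    {b : 𝕏} (hb : b ∈ basePoints Γ) : base Γ ((-1 : SL(2, ℤ)) • b) ≠ b := by
  intro h
  have hbb : base Γ b = b := (Finset.mem_filter.mp hb).2
  have := T_pow_off_smul_base Γ ((-1 : SL(2, ℤ)) • b)
  rw [h] at this
  exact hreg b _ this

variable (Γ) in
/-- A transversal of the pairs `{b, base(-b)}` of base points (via the enumeration `cosetEquiv`).
[folklore] -/
def halfBasePoints : Finset 𝕏 :=
  (basePoints Γ).filter fun b ↦ cosetEquiv Γ b < cosetEquiv Γ (base Γ ((-1 : SL(2, ℤ)) • b))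

/-- Off the transversal, the partner is on it. [folklore] -/
theorem base_neg_mem_halfBasePoints
    (hreg : ∀ (x : 𝕏) (i : ℕ), ModularGroup.T ^ i • x ≠ (-1 : SL(2, ℤ)) • x)
    {b : 𝕏} (hb : b ∈ basePoints Γ) (hnot : b ∉ halfBasePoints Γ) :
    base Γ ((-1 : SL(2, ℤ)) • b) ∈ halfBasePoints Γ := by
  have hbb : base Γ b = b := (Finset.mem_filter.mp hb).2
  rw [halfBasePoints, Finset.mem_filter] at hnot ⊢
  refine ⟨base_mem_basePoints _, ?_⟩
  rw [base_neg_base_neg, hbb]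
  have hne : cosetEquiv Γ (base Γ ((-1 : SL(2, ℤ)) • b)) ≠ cosetEquiv Γ b :=
    fun h ↦ base_neg_ne hreg hb ((cosetEquiv Γ).injective h)
  have hle : ¬ cosetEquiv Γ b < cosetEquiv Γ (base Γ ((-1 : SL(2, ℤ)) • b)) := fun h ↦ hnot ⟨hb, h⟩
  omega

/-- `2 · #halfBasePoints ≤ #basePoints` (the transversal and its image are disjoint). [folklore] -/
theorem two_mul_card_halfBasePoints_le : 2 * (halfBasePoints Γ).card ≤ (basePoints Γ).card := by
  set P := halfBasePoints Γ with hP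
  set ι : 𝕏 → 𝕏 := fun b ↦ base Γ ((-1 : SL(2, ℤ)) • b) with hι
  have hPsub : P ⊆ basePoints Γ := Finset.filter_subset _ _
  have hinj : Set.InjOn ι P := by
    intro b hb b' hb' h
    have h1 := congrArg (fun y ↦ base Γ ((-1 : SL(2, ℤ)) • y)) h
    simp only [hι, base_neg_base_neg] at h1
    rwa [(Finset.mem_filter.mp (hPsub hb)).2, (Finset.mem_filter.mp (hPsub hb')).2] at h1
  have himg : P.image ι ⊆ basePoints Γ := by
    intro y hy
    obtain ⟨b, -, rfl⟩ := Finset.mem_image.mp hy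
    exact base_mem_basePoints _
  have hdisj : Disjoint P (P.image ι) := by
    rw [Finset.disjoint_left]
    intro b hb hb'
    obtain ⟨b₀, hb₀, rfl⟩ := Finset.mem_image.mp hb'
    have h0 := (Finset.mem_filter.mp hb₀).2
    have h1 := (Finset.mem_filter.mp hb).2
    simp only [hι] at h1
    rw [base_neg_base_neg, (Finset.mem_filter.mp (hPsub hb₀)).2] at h1
    omega
  have := Finset.card_le_card (Finset.union_subset hPsub himg)
  rw [Finset.card_union_of_disjoint hdisj, Finset.card_image_of_injOn hinj] at this
  omega

/-- **The values at `i∞` of the conjugates at paired base points**: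
`v(f ∣ base(-x)) = (-1)^k v(f ∣ x)` (`base(-x) = T^{-i}(-x)`, translation does not change the value
at `i∞`, and `f ∣_k(-1) = (-1)^k f`). [folklore] -/
theorem valueAtInfty_cosetSlash_base_neg [Fact (ModularGroup.T ∈ Γ)] {f : ℍ → ℂ}
    (hf : f ∈ levelSpace Γ k) (x : 𝕏) :
    valueAtInfty (cosetSlash Γ k f (base Γ ((-1 : SL(2, ℤ)) • x))) =
      (-1 : ℂ) ^ k * valueAtInfty (cosetSlash Γ k f x) := by
  set i₀ := off Γ ((-1 : SL(2, ℤ)) • x) with hi₀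
  have heq : cosetSlash Γ k f (base Γ ((-1 : SL(2, ℤ)) • x)) =
      transl (i₀ : ℤ) (((-1 : ℂ) ^ k) • cosetSlash Γ k f x) := by
    rw [← T_zpow_neg_off_smul ((-1 : SL(2, ℤ)) • x), cosetSlash_T_zpow_smul hf, neg_neg,
      cosetSlash_neg_one_smul (slash_eq_of_mem_levelSpace hf)]
  have h1 := tendsto_cosetSlash hf (base Γ ((-1 : SL(2, ℤ)) • x))
  have h2 : Tendsto (cosetSlash Γ k f (base Γ ((-1 : SL(2, ℤ)) • x))) atImInfty
      (𝓝 ((-1 : ℂ) ^ k * valueAtInfty (cosetSlash Γ k f x))) := by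
    rw [heq]
    have := ((tendsto_cosetSlash hf x).const_mul ((-1 : ℂ) ^ k)).comp (tendsto_T_zpow_smul_atImInfty (i₀ : ℤ))
    exact this
  exact tendsto_nhds_unique h1 h2

/-- **`2 dim M_k(Γ) ≤ 2 dim S_k(Γ) + #basePoints(Γ)`** when no translate `Tⁱx` of a coset is `-x`:
the cusp values on the transversal `halfBasePoints` already determine all cusp values
(`v(f ∣ base(-b)) = (-1)^k v(f ∣ b)`), and their common kernel consists of cusp forms. [folklore] -/
theorem two_mul_finrank_levelSpace_le [Fact (ModularGroup.T ∈ Γ)] [FiniteDimensional ℂ (CuspForm Γ k)]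
    (hreg : ∀ (x : 𝕏) (i : ℕ), ModularGroup.T ^ i • x ≠ (-1 : SL(2, ℤ)) • x) :
    2 * Module.finrank ℂ (levelSpace Γ k) ≤
      2 * Module.finrank ℂ (CuspForm Γ k) + (basePoints Γ).card := by
  have h3 := two_mul_card_halfBasePoints_le (Γ := Γ)
  set P := halfBasePoints Γ with hP
  let L : levelSpace Γ k →ₗ[ℂ] ({x // x ∈ P} → ℂ) := LinearMap.pi fun b ↦ cuspValueK Γ k b.1
  have hrn := LinearMap.finrank_range_add_finrank_ker L
  have h1 : Module.finrank ℂ (LinearMap.range L) ≤ P.card := by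
    have := Submodule.finrank_le (LinearMap.range L)
    rwa [Module.finrank_fintype_fun_eq_card, Fintype.card_coe] at this
  -- the kernel of `L` is the kernel of the full cusp-value map
  have hker : LinearMap.ker L ≤ LinearMap.ker (cuspValuesK Γ k) := by
    intro f hf
    rw [LinearMap.mem_ker] at hf ⊢
    have hfP : ∀ b ∈ P, cuspValueK Γ k b f = 0 := fun b hb ↦ congr_fun hf ⟨b, hb⟩
    funext ⟨b, hb⟩
    show cuspValueK Γ k b f = 0
    by_cases hbP : b ∈ P
    · exact hfP b hbP
    · have h := hfP _ (base_neg_mem_halfBasePoints hreg hb hbP)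
      have hrel : cuspValueK Γ k (base Γ ((-1 : SL(2, ℤ)) • b)) f = (-1 : ℂ) ^ k * cuspValueK Γ k b f :=
        valueAtInfty_cosetSlash_base_neg f.2 b
      rw [hrel] at h
      exact (mul_eq_zero.mp h).resolve_left (zpow_ne_zero _ (by norm_num))
  have h2 : Module.finrank ℂ (LinearMap.ker L) ≤ Module.finrank ℂ (CuspForm Γ k) :=
    (Submodule.finrank_mono hker).trans
      (LinearMap.finrank_le_finrank_of_injective (kerToCuspFormK_injective (Γ := Γ) (k := k)))
  omega

end Pairs

end Level

/-! ### `Γ₁(N)`, `N ≥ 5`: the odd weights -/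

section Gamma1Odd

variable (N : ℕ) [NeZero N]

omit [NeZero N] in
/-- **No translate `Tⁱx` of a coset of `Γ₁(N)` equals `-x` when `N ≥ 5`** (equivalently `Γ₁(N)`
has no element of trace `-2`, i.e. no irregular cusp: an element `-g⁻¹T^{-i}g ∈ Γ₁(N)` would have
trace `-2 ≡ 2 (mod N)`, forcing `N ∣ 4`). [cite: DiamondShurman2005, §3.8] -/
theorem T_pow_smul_ne_neg_smul_gamma1 (hN : 5 ≤ N) (x : SL(2, ℤ) ⧸ Gamma1 N) (i : ℕ) :
    ModularGroup.T ^ i • x ≠ (-1 : SL(2, ℤ)) • x := by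
  intro h
  induction x using QuotientGroup.induction_on with
  | H g =>
    set A : SL(2, ℤ) := (-1 : SL(2, ℤ)) * ModularGroup.T ^ i with hA
    have h' : A • (g : SL(2, ℤ) ⧸ Gamma1 N) = g := by
      rw [hA, mul_smul, h, smul_smul, show (-1 : SL(2, ℤ)) * -1 = 1 by simp, one_smul]
    rw [Level.smul_mk_eq_iff] at h'
    -- trace of `A` is `-2`
    have htr := trace_conj_eq g A
    have hT : ((A 0 0 : ℤ)) + (A 1 1 : ℤ) = -2 := by
      have e : ((ModularGroup.T ^ i : SL(2, ℤ)) : Matrix (Fin 2) (Fin 2) ℤ) = !![1, (i : ℤ); 0, 1] := by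
        rw [← zpow_natCast]; exact ModularGroup.coe_T_zpow (i : ℤ)
      have hAm : ((A : SL(2, ℤ)) : Matrix (Fin 2) (Fin 2) ℤ) = -!![1, (i : ℤ); 0, 1] := by
        rw [hA, Matrix.SpecialLinearGroup.coe_mul, e]; simp
      change ((A : SL(2, ℤ)) : Matrix (Fin 2) (Fin 2) ℤ) 0 0 + ((A : SL(2, ℤ)) : Matrix (Fin 2) (Fin 2) ℤ) 1 1 = -2
      rw [hAm]
      norm_num
    rw [hT] at htr
    -- but an element of `Γ₁(N)` has trace `≡ 2`
    have hmem := h'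
    rw [Gamma1_mem] at hmem
    obtain ⟨ha, hd, -⟩ := hmem
    have hz : ((((g⁻¹ * A * g : SL(2, ℤ)) 0 0 : ℤ) + ((g⁻¹ * A * g : SL(2, ℤ)) 1 1 : ℤ) : ℤ) : ZMod N) =
        ((-2 : ℤ) : ZMod N) := by rw [htr]
    push_cast at hz
    rw [ha, hd] at hz
    have h4 : (4 : ZMod N) = 0 := by linear_combination hz
    have hdvd : N ∣ 4 := (ZMod.natCast_eq_zero_iff 4 N).mp (by exact_mod_cast h4)
    have := Nat.le_of_dvd (by norm_num) hdvd
    omega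

variable {N}

/-- **The per-weight bookkeeping in odd weight**: for a level-one basis of `M(Γ₁(N))` on
`Fin [SL₂(ℤ):Γ₁(N)]` with weights `≥ 0` (`N ≥ 4`) and odd `k`,
`12 dim M_k(Γ₁(N)) + ∑_{k_j odd} k_j ≥ (k + 5)[SL₂(ℤ):±Γ₁(N)]`: only the odd `k_j` contribute, the
per-weight inequality `w + 12 ≤ 12 dim R_w + 6[4∤w] + 8[w≡2 (6)] + 4[w≡4 (6)]` is summed over them,
and `w = k - k_j` hits the residues `0, 2 (4)` and `0, 2, 4 (6)` equally often
(`card_weights_gamma1`). [cite: DiamondShurman2005, Thm. 3.6.1] -/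
theorem twelve_mul_finrank_gamma1_odd_ge (hN : 4 ≤ N) {wt : Fin (Gamma1 N).index → ℤ}
    {F : Fin (Gamma1 N).index → ℍ → ℂ} (hb : Level.IsLevelBasis (Gamma1 N) wt F)
    (hwt : ∀ j, 0 ≤ wt j) {k : ℤ} (hk : Odd k) :
    (k + 5) * (Gamma1pm N).index ≤
      12 * (Module.finrank ℂ (Level.levelSpace (Gamma1 N) k) : ℤ) +
        ∑ j ∈ Finset.univ.filter (fun j ↦ wt j % 2 = 1), wt j := by
  classical
  have hN3 : 3 ≤ N := by omega
  have hIμ : 2 * (Gamma1pm N).index = (Gamma1 N).index := two_mul_index_gamma1pm_eq N hN3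
  set Jodd := Finset.univ.filter (fun j : Fin (Gamma1 N).index ↦ wt j % 2 = 1) with hJodd
  have hodd_card : 2 * Jodd.card = (Gamma1 N).index := two_mul_card_parity_gamma1 hN hb hwt 1 (Or.inr rfl)
  obtain ⟨hA, -⟩ := card_weights_gamma1 hN hb hwt (k + 2)
  obtain ⟨-, hB⟩ := card_weights_gamma1 hN hb hwt (k - 2)
  obtain ⟨-, hC⟩ := card_weights_gamma1 hN hb hwt (k - 4)
  obtain ⟨k₀, hk₀⟩ := hk
  -- the dimension as a sum over the odd generators
  have hdim : (Module.finrank ℂ (Level.levelSpace (Gamma1 N) k) : ℤ) =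
      ∑ j ∈ Jodd, (Module.finrank ℂ (levelOneSpace (k - wt j)) : ℤ) := by
    rw [hb.finrank_eq k, Nat.cast_sum,
      ← Finset.sum_filter_add_sum_filter_not Finset.univ (fun j ↦ wt j % 2 = 1)]
    have hzero : ∑ j ∈ Finset.univ.filter (fun j ↦ ¬ wt j % 2 = 1),
        (Module.finrank ℂ (levelOneSpace (k - wt j)) : ℤ) = 0 := by
      refine Finset.sum_eq_zero fun j hj ↦ ?_
      have hj := (Finset.mem_filter.mp hj).2
      have hodd : Odd (k - wt j) := by
        have := Int.emod_two_eq_zero_or_one (wt j)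
        exact ⟨(k - wt j) / 2, by omega⟩
      rw [Level.levelOneSpace_eq_bot_of_odd hodd, finrank_bot, Nat.cast_zero]
    rw [hzero, add_zero]
  -- the per-weight inequality summed over the odd generators
  have hsum := Finset.sum_le_sum (s := Jodd) fun j hj ↦
    twelve_mul_finrank_levelOneSpace_ge (w := k - wt j)
      (by have := (Finset.mem_filter.mp hj).2; exact ⟨(k - wt j) / 2, by omega⟩)
  -- identify the residue counts inside `Jodd`
  have e4 : (Jodd.filter fun j ↦ ¬ (4 : ℤ) ∣ k - wt j) =
      Finset.univ.filter fun j ↦ (4 : ℤ) ∣ wt j - (k + 2) := by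
    ext j
    simp only [hJodd, Finset.mem_filter, Finset.mem_univ, true_and]
    constructor
    · rintro ⟨h1, h2⟩; omega
    · intro h; omega
  have e62 : (Jodd.filter fun j ↦ (k - wt j) % 6 = 2) =
      Finset.univ.filter fun j ↦ (6 : ℤ) ∣ wt j - (k - 2) := by
    ext j
    simp only [hJodd, Finset.mem_filter, Finset.mem_univ, true_and]
    constructor
    · rintro ⟨h1, h2⟩; omega
    · intro h; omega
  have e64 : (Jodd.filter fun j ↦ (k - wt j) % 6 = 4) =
      Finset.univ.filter fun j ↦ (6 : ℤ) ∣ wt j - (k - 4) := by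
    ext j
    simp only [hJodd, Finset.mem_filter, Finset.mem_univ, true_and]
    constructor
    · rintro ⟨h1, h2⟩; omega
    · intro h; omega
  simp only [Finset.sum_add_distrib, ← Finset.mul_sum, Finset.sum_boole, Finset.sum_sub_distrib,
    Finset.sum_const, nsmul_eq_mul] at hsum
  rw [e4, e62, e64] at hsum
  rw [hdim]
  have hA' : (4 : ℤ) * ((Finset.univ.filter fun j ↦ (4 : ℤ) ∣ wt j - (k + 2)).card : ℤ) =
      (Gamma1 N).index := by exact_mod_cast hA
  have hB' : (6 : ℤ) * ((Finset.univ.filter fun j ↦ (6 : ℤ) ∣ wt j - (k - 2)).card : ℤ) =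
      (Gamma1 N).index := by exact_mod_cast hB
  have hC' : (6 : ℤ) * ((Finset.univ.filter fun j ↦ (6 : ℤ) ∣ wt j - (k - 4)).card : ℤ) =
      (Gamma1 N).index := by exact_mod_cast hC
  have hJ' : (2 : ℤ) * (Jodd.card : ℤ) = (Gamma1 N).index := by exact_mod_cast hodd_card
  have hIμ' : (2 : ℤ) * ((Gamma1pm N).index : ℤ) = (Gamma1 N).index := by exact_mod_cast hIμ
  have hcard : (Jodd.card : ℤ) = (Gamma1pm N).index := by linarith
  rw [hcard] at hsum
  linarith

variable (N)

/-- **`12 dim S_k(Γ₁(N)) ≥ (k-1)[SL₂(ℤ):±Γ₁(N)] - 6ε_∞` for `N ≥ 5` and every odd `k`**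
(`ε_∞ = #Level.basePoints(±Γ₁(N))`, the `⟨T⟩`-orbit count of `ModularFormsGamma1Dimension`) — the
existence half of Diamond–Shurman Thm. 3.6.1 / Fig. 3.4 for `Γ₁(N)` in odd weight (for `k ≥ 3` the
left side is `12` times the exact dimension `(k-1)(g-1) + (k/2-1)ε_∞`, all cusps being regular for
`N ≠ 4`). The count `c = #Level.basePoints(Γ₁(N))` cancels between the cusp constraint of the mixed
basis (`∑ k_j + 6c = 12μ₁`), that of its even part (`∑_{even} k_j + 6ε_∞ = 6μ₁`) and the paired
cusp-value bound (`2 dim M_k ≤ 2 dim S_k + c`). [cite: DiamondShurman2005, Thm. 3.6.1, Fig. 3.4] -/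
theorem le_twelve_mul_finrank_cuspForm_gamma1_odd (hN : 5 ≤ N) {k : ℤ} (hk : Odd k) :
    (k - 1) * (Gamma1pm N).index - 6 * (Level.basePoints (Gamma1pm N)).card ≤
      12 * (Module.finrank ℂ (CuspForm (Gamma1 N) k) : ℤ) := by
  classical
  have hN3 : 3 ≤ N := by omega
  have hN4 : 4 ≤ N := by omega
  obtain ⟨wt, F, hb, hwt, hD⟩ := exists_isLevelBasis_gamma1 N hN3
  have hIμ : 2 * (Gamma1pm N).index = (Gamma1 N).index := two_mul_index_gamma1pm_eq N hN3
  -- (1) cusp constraint of the mixed basis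
  have htot := Level.totalWeight_eq' hb hD hwt
  -- (2) the even part is a level-one basis of `M(±Γ₁(N))` on `μ₁` generators
  set J₀ := Finset.univ.filter (fun j : Fin (Gamma1 N).index ↦ wt j % 2 = 0) with hJ₀
  have hJ₀card : Fintype.card {j : Fin (Gamma1 N).index // wt j % 2 = 0} = (Gamma1pm N).index := by
    have h := two_mul_card_parity_gamma1 hN4 hb hwt 0 (Or.inl rfl)
    rw [Fintype.card_subtype]
    omega
  let e₀ : Fin (Gamma1pm N).index ≃ {j : Fin (Gamma1 N).index // wt j % 2 = 0} :=
    (Fintype.equivFinOfCardEq hJ₀card).symm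
  have hb₀ : Level.IsLevelBasis (Gamma1pm N) (fun i ↦ wt (e₀ i)) (fun i ↦ F (e₀ i)) :=
    Level.isLevelBasis_adjoinNegI_evenPart hb e₀
  have hwt₀ : ∀ i, 0 ≤ wt (e₀ i) ∧ Even (wt (e₀ i)) := fun i ↦
    ⟨hwt _, Int.even_iff.mpr (e₀ i).2⟩
  have heven := Level.totalWeight_eq hb₀ (rankInputGamma1pm N hN3) hwt₀
  -- the even weight sum is the sum over `J₀`
  have hSeven : Level.totalWeight (Gamma1pm N) (fun i ↦ wt (e₀ i)) = ∑ j ∈ J₀, wt j := by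
    unfold Level.totalWeight
    rw [hJ₀, Finset.sum_subtype (Finset.univ.filter fun j : Fin (Gamma1 N).index ↦ wt j % 2 = 0)
      (p := fun j ↦ wt j % 2 = 0) (fun j ↦ by simp)]
    exact Fintype.sum_equiv e₀ _ (fun x : {j : Fin (Gamma1 N).index // wt j % 2 = 0} ↦ wt x)
      fun i ↦ rfl
  -- the odd weight sum
  have hsplit : Level.totalWeight (Gamma1 N) wt =
      ∑ j ∈ J₀, wt j + ∑ j ∈ Finset.univ.filter (fun j : Fin (Gamma1 N).index ↦ wt j % 2 = 1), wt j := by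
    unfold Level.totalWeight
    rw [← Finset.sum_filter_add_sum_filter_not Finset.univ (fun j : Fin (Gamma1 N).index ↦ wt j % 2 = 0)]
    congr 1
    refine Finset.sum_congr (Finset.filter_congr fun j _ ↦ ?_) fun _ _ ↦ rfl
    have := Int.emod_two_eq_zero_or_one (wt j)
    omega
  -- (3) bookkeeping in odd weight
  have hbook := twelve_mul_finrank_gamma1_odd_ge hN4 hb hwt hk
  -- (4) the paired cusp-value bound (`S_k(Γ₁(N))` is finite-dimensional by Sturm)
  haveI : FiniteDimensional ℂ (CuspForm (Gamma1 N) k) :=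
    (finiteDimensional_cuspForm_and_finrank_le (𝒢 := Gamma1 N) (k := k)
      (Level.one_mem_strictPeriods (Gamma1 N))).1
  have hpair := Level.two_mul_finrank_levelSpace_le (Γ := Gamma1 N) (k := k)
    (T_pow_smul_ne_neg_smul_gamma1 N hN)
  rw [finrank_formSpace] at hpair
  have hMS : (Module.finrank ℂ (Level.levelSpace (Gamma1 N) k) : ℤ) =
      Module.finrank ℂ (ModularForm (Gamma1 N) k) := by
    rw [finrank_formSpace]
  -- assemble
  rw [hSeven] at heven
  rw [hsplit] at htot
  have hpair' : (2 * Module.finrank ℂ (ModularForm (Gamma1 N) k) : ℤ) ≤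
      2 * Module.finrank ℂ (CuspForm (Gamma1 N) k) + (Level.basePoints (Gamma1 N)).card := by
    exact_mod_cast hpair
  rw [hMS] at hbook
  have hIμ' : (2 : ℤ) * ((Gamma1pm N).index : ℤ) = (Gamma1 N).index := by exact_mod_cast hIμ
  nlinarith [htot, heven, hbook, hpair', hIμ']

/-- **`12 dim S_k(Γ₁(N)) ≥ (k-1)[SL₂(ℤ):±Γ₁(N)] - 6ε_∞` for `N ≥ 5` in every weight `k`** (even `k`:
`le_twelve_mul_finrank_cuspForm_gamma1` of `ModularFormsGamma1Dimension`; odd `k`: the above) — the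
dimension lower bound consumed by the rank half of Eichler–Shimura on `Γ₁(N)` in all weights.
[cite: DiamondShurman2005, Thm. 3.5.1, Thm. 3.6.1, Fig. 3.4] -/
theorem le_twelve_mul_finrank_cuspForm_gamma1_all (hN : 5 ≤ N) (k : ℤ) :
    (k - 1) * (Gamma1pm N).index - 6 * (Level.basePoints (Gamma1pm N)).card ≤
      12 * (Module.finrank ℂ (CuspForm (Gamma1 N) k) : ℤ) := by
  rcases Int.even_or_odd k with hk | hk
  · exact le_twelve_mul_finrank_cuspForm_gamma1 N (by omega) hk
  · exact le_twelve_mul_finrank_cuspForm_gamma1_odd N hN hk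

end Gamma1Odd

end Literature.NumberTheory.EllipticCurves.ModularForms
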